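import Mathlib
import Summits.Ventures.FusionMHD.Models.CerfonFreidbergIterLikeQHalfMercDefs
import HarnessLib

/-!
# Ventures/FusionMHD — Models/CerfonFreidbergIterLikeQHalfMercPanels16.lean: KERNEL CHECK of the Mercier-register certificates of panel(s) 28 (of 32)
# at `ψ_N = 1/2` of THE Cerfon–Freidberg ITER-like instance

HONEST FRAMING (LADDER-GRIDFUSION three columns; CF rung; «F2.R2-CF-MERCIER-IMPLICIT» step (2), F2-SCOPING v1.6 §10(c)).  One `decide +kernel` (≈ 50 s): for each
listed panel the obligation `CFIterLike.QHalfMerc.MercCert.ok` (`Models/CerfonFreidbergIterLikeQHalfMercDefs.lean`) — the Taylor-model run of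
`progM = progA ++ block1 ++ block2 ++ block3M` over ★ #117's parameter box is ACCEPTED (both `inv` certificates included) and the kernel's FOUR panel-integral
enclosures (`g_W`, `g_Aσ`, `g_AR`, `g_B1` along the approximant) lie inside the claimed integers (read off a compiled `#eval` of the same functions, slack one unit of
`2⁻⁶⁰`; float truth inside every panel, `HOME/models/model-7/g7/genqm/truthM.json`).  MODELLED: analytic Cerfon–Freidberg family; nothing about a device or
stability.  No `native_decide`.  Typer/prover: gridfusion-model-7 (g7), 2026-08-27.
Citations: Jardin 2010 §8.5 (8.134) [Jardin2010]; Mahboubi–Melquiond–Sibut-Pinote 2016 §3.2 Lemma 3 [MahboubiMelquiondSibutpinote2016].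
-/

namespace Summit.Ventures.FusionMHD.Models.CFIterLike.QHalfMerc

/-- Mercier-register certificate data of panel(s) 28. [instance data] -/
def mercCert16 : List MercCert := [
  { j := 28, cand1 := [870230536419482533888, -2377174170754471165952, 14045034956973810909184, -30661640444804245487616, 85311926874498649817088, -33908251535884375031808, -471745650697591500832768, 3580338208096376770789376, -15415341466166725296783360, 69166040443852190031806464, 965266818544096326543474688, -25689927559843119480698830848, -1555154971723839266239639715840],
    cand2 := [659518986534576586752, -1142938153962231037952, 6842187510114213167104, -16657240392774918864896, 60977906103331432955904, -145451973901217412677632, 373410781795684385292288, -566970526026039606378496, -451253854432774731071488, 19479394635244848155721728, 1552509250731096629540028416, -18681035708440029698916876288, -2242768593754136653049532252160],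
    deg := 10, e1 := 43, e2 := 43, wlo := 707703814042006305, whi := 707703862051423996, slo := 10699809451952738219, shi := 10699809766518113214,
    rlo := 6963343115166218634, rhi := 6963343326656714993, blo := 16441280047535972890, bhi := 16441280514994996377 }]

/-- **KERNEL CHECK** of the four Mercier registers on panel(s) 28. -/
theorem mercCert16_ok : CFIterLike.QHalfMerc.mercCert16.all MercCert.ok = true := by
  decide +kernel

end Summit.Ventures.FusionMHD.Models.CFIterLike.QHalfMerc
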